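import Summits.ABC.IUTFork.Cor312CheckBGluedRegions
import Summits.ABC.IUTFork.Cor312TeamAGapWitnessB
import Summits.ABC.IUTFork.Cor312ScaledCopiesWitness
import HarnessLib

/-!
# [IUTchIII] Cor. 3.12 — check (B)/(C): the tree's countermodels live EXACTLY in the complement of the q-gluing
# clause (b2)

Record-only companion (D-0012; wave-5 prover abc-iut-w5-d155) of `Cor312CheckBGluedRegions.lean`; TAKES NO SIDE;
proof-only. Director-abc 00:45:37Z, check (C): «does each model succeed ONLY because the Θ/q-glue fields are free?»
Kernel answer for the two (G3)/(R) countermodels of record, in the currency of check (B): at Team A's `gapSetting`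
(`Cor312TeamAGapWitness`/`B`) and at w4-d101's scaled-copies `ssSetting` (`Cor312ScaledCopiesWitness`) — both of
which satisfy the typed Theorem 3.11 in full, all bridge hypotheses and `|log(q)| > 0`, and refute the typed
Corollary — the pair of gluing clauses (b1) `ComputedBy P A` ∧ (b2) «q-region = the same region algorithm on some
column's data» is UNSATISFIABLE for every region algorithm `A` and every column `n'`. So these witnesses refute
the Corollary precisely by choosing the q-glue OUTSIDE (b2): they certify non-derivability from the typed Thm 3.11
+ side conditions (free glue), and say nothing against «typed Thm 3.11 (i) + (b1) + (b2) ⊢ Cor 3.12» (which is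
`statement_of_gluedRegions`). Bookkeeping; [claim: Mochizuki2012, status: disputed] for the statements involved.
-/

namespace Summit.ABC.IUTFork

namespace Thm311ToCor312

open Thm311 Cor312 Cor312.Checks Cor312Vol

/-- Generic form: wherever the typed Corollary FAILS under the bridge hypotheses and Theorem 3.11 (i)'s multiradial
compatibility holds, the gluing pair (b1) ∧ (b2) is unsatisfiable. [claim: Mochizuki2012, status: disputed] -/
theorem not_glued_of_not_statement {T : ThetaIndex} {S : Situation T} (P : Setting S) (H : BridgeHyps P)
    (hS : S.MultiradialCompat) (hnot : ¬ Summit.ABC.IUTFork.Cor312.Setting.Statement P) (A : RegionAlgorithm S)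
    (n' : ℤ) : ¬ (ComputedBy P A ∧ ∀ (j : T.Label) (vQ : T.VQ), P.qRegion j vQ = A.ρ (S.D n') j vQ) :=
  fun h => hnot (statement_of_gluedRegions A P H hS h.1 n' h.2)

/-- **At Team A's gap witness** (typed Thm 3.11 holds: `gap_partI`; bridge hypotheses; `¬ Statement`): no region
algorithm computes both its Θ-glue and its q-glue — the witness sits outside (b2). [claim: Mochizuki2012, status: disputed] -/
theorem gapSetting_not_glued (A : RegionAlgorithm GapWitness.gapSituation) (n' : ℤ) :
    ¬ (ComputedBy GapWitness.gapSetting A ∧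
        ∀ (j : toyIndex.Label) (vQ : toyIndex.VQ),
          GapWitness.gapSetting.qRegion j vQ = A.ρ (GapWitness.gapSituation.D n') j vQ) :=
  not_glued_of_not_statement _ GapWitness.gapSetting_bridgeHyps GapWitness.gap_partI.2.2
    GapWitness.gapSetting_not_statement A n'

/-- **At the scaled-copies witness** (honest `q^{j²}`- versus `q`-copies; typed Thm 3.11 holds: `ss_partI`):
likewise — the faithful-computation horn is exactly a violation of (b2). [claim: Mochizuki2012, status: disputed] -/
theorem ssSetting_not_glued (A : RegionAlgorithm Cor312.ScaledCopies.ssSituation) (n' : ℤ) :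
    ¬ (ComputedBy Cor312.ScaledCopies.ssSetting A ∧
        ∀ (j : toyIndex.Label) (vQ : toyIndex.VQ),
          Cor312.ScaledCopies.ssSetting.qRegion j vQ = A.ρ (Cor312.ScaledCopies.ssSituation.D n') j vQ) :=
  not_glued_of_not_statement _ Cor312.ScaledCopies.ssSetting_bridgeHyps Cor312.ScaledCopies.ss_partI.2.2
    Cor312.ScaledCopies.ssSetting_not_statement A n'

end Thm311ToCor312

end Summit.ABC.IUTFork
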